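import Summits.QuantumFields.YangMills.Theorems.BalabanUVNodesN20BlockCaricatureSummableStatistic

/-!
# BalabanUVNodes ∕ N19·N20 — THE INDEPENDENT-BLOCK CARICATURE AT A FIXED RATE RATIO: the near side is LINEAR in the mean large-field count
# (`|μ_B(𝒮) − μ_A(𝒮)| ≤ n·|q − p|`, Pascal's rule on the powerset), so at `q_K = κ·p_K` the face triple of K3⁷ stub 2 on the caricature carriers is
# EXACTLY «`Σ_K n_K p_K < ∞`» — dag-n20-w1's `ℓ¹ ∕ ℓ^{1∕2}` squeeze closes in the rare regime

Cell `pub-ymgap` (HUMAN RULING D-0062 Track A ∕ D-0149 width seats), WIDTH SEAT `pub-ymgap-dag-n19-w2` (node n19 = NE7, seat 2 of 3), generation g5; DECL-DELTA-2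
(INBOX l.31248; re-scope after dag-lead DEDUP-388 (1): the finite-index Le Cam letters, the caricature's affinity power law and the summable-statistic necessity have ONE
declarer, dag-n20-w1 g5 — `…N20BlockCaricatureAffinity` p611611, `…LawSeparation` p612589, `…SummableStatistic`; this file imports them BY NAME and adds only the
disjoint pieces).  Route `Summits/QuantumFields/YangMills/Theses/BalabanUVNodes.lean`, key item K3⁷ `SpineGivenEndpointR13SepCoPH` (stmt-QuantumFields-20544); filed
`--kind proof --supports … --as helper`.  COUNT-NEUTRAL.  THEOREMS ONLY (0 `def`, 0 `instance`, 0 `sorry`); imports dag-n20-w1's FILE C `…N20BlockCaricatureSummableStatistic`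
(through it their FILES A∕B, dag-n20-w4's `…N20HybridClassLawCharacterisation` p609004 and dag-n19-w4's `…N19NoDialRescuesLawSeparated`); edits nothing, re-declares nothing.

THE CARICATURE (dag-n20-w1's letters VERBATIM): at step `K`, `n_K` independent level-1 blocks, each large-field with probability `p_K` under run A and `q_K` under run B;
classes = configurations `S ⊆ range n_K`; carriers `T K = (range n_K).powerset`, class weights `p_K^{#S}(1−p_K)^{n_K−#S}` ∕ `q_K^{#S}(1−q_K)^{n_K−#S}` (totals `1`).  Their
FILE C squeezes the face triple of stub 2 there between `Σ_K Λ_K < ∞` (necessary) and `Σ_K √Λ_K < ∞` (sufficient), `Λ_K = n_K(q_K − p_K)²(1∕(p_K+q_K) + 1∕(2−p_K−q_K))`,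
the square root coming from Le Cam's UPPER inequality `TV ≤ √(1 − BC²) ≤ √Λ`.

THE ONE NEW THING.  Total variation of product laws is SUB-ADDITIVE over the blocks (this seat's g4 `…N19TVProductBlockFamily` at the measure level); on the caricature this is
the elementary bound `|μ_B(𝒮) − μ_A(𝒮)| ≤ n·|q − p|` for EVERY class set `𝒮` (§1, by Pascal's rule `E_{n+1,p}[φ] = (1−p)·E_{n,p}[φ] + p·E_{n,p}[φ(· ∪ {n})]` and induction
on `n` — no coupling, no affinity).  In the RARE regime at a fixed rate ratio `q = κp` this LINEAR bound `n p|κ − 1|` beats `√Λ ≍ √(n p)` exactly when `n p ≲ 1`, i.e. where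
summability is decided, and `Λ ≥ n p (κ−1)²∕(1+κ)` (§2); so at `q_K = κ p_K`, `κ ∉ {0, 1}`:
  face triple (∃ `Bad, W, shA, shB, Wsh, δ`) on the caricature carriers ⟺ `Σ_K n_K p_K < ∞` ⟺ `∃ shA shB Wsh, HybridNE7 … ∅ 0 shA shB Wsh 0`   (§3 ★★★★),
necessity by dag-n20-w1's `summable_stat_of_faces_caricature` (Kakutani ∕ Le Cam LOWER), sufficiency by §1 fed to dag-n20-w4's `exists_hybridNE7_of_target_of_classLawTV`
(p609004) with the shell weight `min (n_K p_K |κ − 1|) √(1 − u_K^{2 n_K}) < 1`.  The mean large-field count `n_K p_K` summed over the scales — Bałaban's own large-field RARITY in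
its global form — is the exact price of the stub-2 triple on this caricature; no square root.

WHAT IS PROVED ([folklore] finite sums + tree theorems BY NAME).
* §1 `config_weight_succ_of_subset` · `config_weight_succ_insert` · ★ `configExpect_succ` (Pascal on the powerset) · `configExpect_mem_unit` · ★★ `abs_configExpect_sub_le`
  (`|E_{n,q}[φ] − E_{n,p}[φ]| ≤ n|q − p|` for `0 ≤ φ ≤ 1`) · ★ `abs_config_classLaw_sub_le` (every class set).
* §2 `stat_ratio_ge` (`q = κp`: `n p (κ−1)²∕(1+κ) ≤ Λ`) · ★★ `summable_meanCount_of_faces_caricature_ratio` (faces ⇒ `Σ n_K p_K < ∞`; dag-n20-w1 FILE C BY NAME) ·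
  `summable_meanCount_of_hybridNE7_caricature_ratio` (the bundled `HybridNE7` form).
* §3 `affinity₁_ratio_pos` (`κ > 0`, `p ∈ [0,1]` ⇒ `u > 0`) · ★★ `exists_hybridNE7_caricature_of_summable_meanCount` (p609004 BY NAME; `Bad = ∅`, `W = 0`, `δ = 0`) ·
  ★★★★ `exists_hybridNE7_caricature_iff_summable_meanCount` · ★★ `faces_caricature_iff_summable_meanCount`.

HONEST FRAMING.  [folklore] finite-sum probability on a CARICATURE (independent blocks, product Bernoulli class weights, a FIXED rate ratio — all HYPOTHESES; nothing read at the
record's `classSet₁₃ ∕ weightA₁₃ ∕ weightB₁₃`); proves NO estimate of Bałaban's; refutes NO registered stub (every negative statement concerns the caricature carriers); whether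
the record's two runs have per-block large-field rates at a bounded ratio is NOT decided here; NE7 ∕ NE7b ∕ NE7c NOT PRINTED as two-run statements for d = 4 and NOT proved;
N19 ∕ N20 ∕ N21 NOT discharged; K3⁷ OPEN, skeleton v5 941dddb108cbaacf STANDS; no summit statement is proved by this seat; counts UNMOVED (typed 28∕28 · discharged 5∕27, A 5∕28);
no count claim.  One finite four-torus programme at fixed ε — NOT ℝ⁴, NOT infinite volume, NOT OS, NOT a mass gap, NOT the Clay problem (R4 closes the conditional finite-𝕋⁴ rung
`BalabanLadder.UV` only).  0 `def`; 0 `sorry`; standard axioms.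
-/

set_option autoImplicit false

noncomputable section

open Finset Filter
open Literature.MathematicalPhysics.QuantumFieldTheory.Balaban1983to89
open Literature.MathematicalPhysics.QuantumFieldTheory.Balaban1983to89.T4WeightBudget
open Literature.MathematicalPhysics.QuantumFieldTheory.Balaban1983to89.T4IndicatorShell
open Literature.MathematicalPhysics.QuantumFieldTheory.Balaban1983to89.T4MatchingAssembly (HybridNE7)
open Summit.QuantumFields.BalabanUV.T4Continuum.Spine.NE7
open Summit.QuantumFields.YangMills.BalabanUVNodes.N20BlockCaricatureAffinity
open Summit.QuantumFields.YangMills.BalabanUVNodes.N20BlockCaricatureLawSeparation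
open Summit.QuantumFields.YangMills.BalabanUVNodes.N20BlockCaricatureSummableStatistic
open Summit.QuantumFields.YangMills.BalabanUVNodes.N20HybridClassLawCharacterisation (exists_hybridNE7_of_target_of_classLawTV)

namespace Summit.QuantumFields.YangMills.BalabanUVNodes.N19BlockCaricatureFixedRatio

/-! ## §1 Pascal's rule on the powerset: configuration expectations are `n`-Lipschitz in the rate [folklore] -/

section Pascal

variable {p q : ℝ}

/-- A configuration `t ⊆ range n` read at `n + 1` blocks with the new block NOT large-field: weight `× (1 − p)`. [folklore] -/
theorem config_weight_succ_of_subset (p : ℝ) {n : ℕ} {t : Finset ℕ} (ht : t ∈ (range n).powerset) :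
    p ^ t.card * (1 - p) ^ (n + 1 - t.card) = (1 - p) * (p ^ t.card * (1 - p) ^ (n - t.card)) := by
  have hc : t.card ≤ n := by simpa using card_le_card (mem_powerset.1 ht)
  rw [Nat.succ_sub hc, pow_succ]
  ring

/-- … and with the new block large-field (`insert n t`): weight `× p`. [folklore] -/
theorem config_weight_succ_insert (p : ℝ) {n : ℕ} {t : Finset ℕ} (ht : t ∈ (range n).powerset) :
    p ^ (insert n t).card * (1 - p) ^ (n + 1 - (insert n t).card) = p * (p ^ t.card * (1 - p) ^ (n - t.card)) := by
  have hn : n ∉ t := fun h => by simpa using mem_powerset.1 ht h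
  rw [card_insert_of_notMem hn, Nat.add_sub_add_right, pow_succ]
  ring

/-- ★ **PASCAL's RULE ON THE POWERSET**: `E_{n+1,p}[φ] = (1 − p)·E_{n,p}[φ] + p·E_{n,p}[φ(· ∪ {n})]` (condition on the last block; `Finset.sum_powerset_insert`). [folklore] -/
theorem configExpect_succ (p : ℝ) (n : ℕ) (φ : Finset ℕ → ℝ) :
    ∑ S ∈ (range (n + 1)).powerset, p ^ S.card * (1 - p) ^ (n + 1 - S.card) * φ S =
      (1 - p) * ∑ S ∈ (range n).powerset, p ^ S.card * (1 - p) ^ (n - S.card) * φ S +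
        p * ∑ S ∈ (range n).powerset, p ^ S.card * (1 - p) ^ (n - S.card) * φ (insert n S) := by
  rw [range_add_one, sum_powerset_insert (notMem_range_self (n := n)), mul_sum, mul_sum]
  congr 1
  · exact sum_congr rfl fun t ht => by rw [config_weight_succ_of_subset p ht]; ring
  · exact sum_congr rfl fun t ht => by rw [config_weight_succ_insert p ht]; ring

/-- A configuration expectation of a `[0,1]`-valued test function lies in `[0,1]`. [folklore] -/
theorem configExpect_mem_unit (hp0 : 0 ≤ p) (hp1 : p ≤ 1) (n : ℕ) {φ : Finset ℕ → ℝ} (hφ : ∀ S, 0 ≤ φ S ∧ φ S ≤ 1) :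
    0 ≤ ∑ S ∈ (range n).powerset, p ^ S.card * (1 - p) ^ (n - S.card) * φ S ∧
      ∑ S ∈ (range n).powerset, p ^ S.card * (1 - p) ^ (n - S.card) * φ S ≤ 1 := by
  refine ⟨sum_nonneg fun S _ => mul_nonneg (config_nonneg hp0 hp1 n S) (hφ S).1, ?_⟩
  calc ∑ S ∈ (range n).powerset, p ^ S.card * (1 - p) ^ (n - S.card) * φ S
      ≤ ∑ S ∈ (range n).powerset, p ^ S.card * (1 - p) ^ (n - S.card) :=
        sum_le_sum fun S _ => mul_le_of_le_one_right (config_nonneg hp0 hp1 n S) (hφ S).2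
    _ = 1 := sum_config_eq_one p n

/-- ★★ **THE TV-NEAR SIDE IS LINEAR: configuration expectations are `n`-Lipschitz in the rate.**  For every test function `0 ≤ φ ≤ 1` and rates `p, q ∈ [0,1]`,
`|E_{n,q}[φ] − E_{n,p}[φ]| ≤ n·|q − p|` (induction on `n` through Pascal's rule; no coupling, no affinity). [folklore] -/
theorem abs_configExpect_sub_le (hp0 : 0 ≤ p) (hp1 : p ≤ 1) (hq0 : 0 ≤ q) (hq1 : q ≤ 1) (n : ℕ) :
    ∀ φ : Finset ℕ → ℝ, (∀ S, 0 ≤ φ S ∧ φ S ≤ 1) →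
      |∑ S ∈ (range n).powerset, q ^ S.card * (1 - q) ^ (n - S.card) * φ S -
          ∑ S ∈ (range n).powerset, p ^ S.card * (1 - p) ^ (n - S.card) * φ S| ≤ n * |q - p| := by
  induction n with
  | zero =>
      intro φ _
      simp
  | succ n ih =>
      intro φ hφ
      have hφ' : ∀ S, 0 ≤ φ (insert n S) ∧ φ (insert n S) ≤ 1 := fun S => hφ (insert n S)
      rw [configExpect_succ q n φ, configExpect_succ p n φ]
      set Ep := ∑ S ∈ (range n).powerset, p ^ S.card * (1 - p) ^ (n - S.card) * φ S
      set Eq := ∑ S ∈ (range n).powerset, q ^ S.card * (1 - q) ^ (n - S.card) * φ S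
      set Fp := ∑ S ∈ (range n).powerset, p ^ S.card * (1 - p) ^ (n - S.card) * φ (insert n S)
      set Fq := ∑ S ∈ (range n).powerset, q ^ S.card * (1 - q) ^ (n - S.card) * φ (insert n S)
      have h1 : |Eq - Ep| ≤ n * |q - p| := ih φ hφ
      have h2 : |Fq - Fp| ≤ n * |q - p| := ih (fun S => φ (insert n S)) hφ'
      obtain ⟨hEp0, hEp1⟩ := configExpect_mem_unit hp0 hp1 n hφ
      obtain ⟨hFp0, hFp1⟩ := configExpect_mem_unit hp0 hp1 n hφ'
      have h3 : |Fp - Ep| ≤ 1 := abs_le.2 ⟨by linarith, by linarith⟩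
      calc |(1 - q) * Eq + q * Fq - ((1 - p) * Ep + p * Fp)|
          = |(1 - q) * (Eq - Ep) + q * (Fq - Fp) + (q - p) * (Fp - Ep)| := by ring_nf
        _ ≤ |(1 - q) * (Eq - Ep)| + |q * (Fq - Fp)| + |(q - p) * (Fp - Ep)| := abs_add_three _ _ _
        _ = (1 - q) * |Eq - Ep| + q * |Fq - Fp| + |q - p| * |Fp - Ep| := by
            rw [abs_mul, abs_mul, abs_mul, abs_of_nonneg (sub_nonneg.2 hq1), abs_of_nonneg hq0]
        _ ≤ (1 - q) * (n * |q - p|) + q * (n * |q - p|) + |q - p| * 1 := by gcongr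
        _ = (n + 1 : ℕ) * |q - p| := by push_cast; ring

/-- ★ **EVERY CLASS SET OF THE CARICATURE HAS GAP AT MOST `n·|q − p|`** (the indicator of `𝒮` as test function; totals are `1`, so the normalised class laws of dag-n20-w4's
letters are the plain sums).  Compare dag-n20-w1 FILE B `abs_sub_config_le_sqrt_stat` (`≤ √Λ`): the linear bound wins iff `n|q − p| ≤ √Λ`, i.e. in the rare regime `n p ≲ 1`
at a fixed ratio. [folklore] -/
theorem abs_config_classLaw_sub_le (hp0 : 0 ≤ p) (hp1 : p ≤ 1) (hq0 : 0 ≤ q) (hq1 : q ≤ 1) (n : ℕ) {𝒮 : Finset (Finset ℕ)}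
    (h𝒮 : 𝒮 ⊆ (range n).powerset) :
    |∑ S ∈ 𝒮, q ^ S.card * (1 - q) ^ (n - S.card) - ∑ S ∈ 𝒮, p ^ S.card * (1 - p) ^ (n - S.card)| ≤ n * |q - p| := by
  classical
  have hind : ∀ c : ℝ, ∑ S ∈ 𝒮, c ^ S.card * (1 - c) ^ (n - S.card) =
      ∑ S ∈ (range n).powerset, c ^ S.card * (1 - c) ^ (n - S.card) * (if S ∈ 𝒮 then (1 : ℝ) else 0) := by
    intro c
    calc ∑ S ∈ 𝒮, c ^ S.card * (1 - c) ^ (n - S.card)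
        = ∑ S ∈ (range n).powerset ∩ 𝒮, c ^ S.card * (1 - c) ^ (n - S.card) := by rw [inter_eq_right.2 h𝒮]
      _ = ∑ S ∈ (range n).powerset, (if S ∈ 𝒮 then c ^ S.card * (1 - c) ^ (n - S.card) else 0) := (sum_ite_mem _ _ _).symm
      _ = _ := sum_congr rfl fun S _ => by split_ifs <;> simp
  rw [hind q, hind p]
  exact abs_configExpect_sub_le hp0 hp1 hq0 hq1 n _ fun S => by split_ifs <;> norm_num

end Pascal

/-! ## §2 Fixed rate ratio `q = κ·p`: the statistic dominates the mean count; the faces force `Σ_K n_K p_K < ∞` [folklore + FILE C BY NAME] -/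

section Ratio

/-- At `q = κp` (`p ≥ 0`): `n·p·(κ−1)²∕(1+κ) ≤ Λ = n·((q−p)²∕(p+q) + (q−p)²∕(2−p−q))` for `p, q ≤ 1` (the one-sided letter alone already dominates: `(q−p)²∕(p+q) =
p(κ−1)²∕(1+κ)`; at `p = 0` both sides vanish, Lean's `0∕0 = 0` included). [folklore] -/
theorem stat_ratio_ge {κ p : ℝ} (hκ : 0 ≤ κ) (hp0 : 0 ≤ p) (hp1 : p ≤ 1) (hq1 : κ * p ≤ 1) (n : ℕ) :
    (n : ℝ) * p * ((κ - 1) ^ 2 / (1 + κ)) ≤ n * ((κ * p - p) ^ 2 / (p + κ * p) + (κ * p - p) ^ 2 / (2 - p - κ * p)) := by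
  have hn : (0 : ℝ) ≤ n := Nat.cast_nonneg n
  have h1 := stat₁_le_statSym₁ (p := p) (q := κ * p) hp1 hq1
  have hone : (κ * p - p) ^ 2 / (p + κ * p) = p * ((κ - 1) ^ 2 / (1 + κ)) := by
    rcases hp0.eq_or_lt with h0 | hpos
    · rw [← h0]; simp
    · have h1k : 0 < 1 + κ := by linarith
      field_simp
  rw [mul_assoc]
  exact mul_le_mul_of_nonneg_left (hone ▸ h1) hn

variable (n : ℕ → ℕ) (p : ℕ → ℝ) (κ : ℝ)

/-- ★★ **AT A FIXED RATE RATIO THE FACES FORCE A SUMMABLE MEAN LARGE-FIELD COUNT.**  `κ ≥ 0`, `κ ≠ 1`, rates `p_K, κp_K ∈ [0,1]`; if some `(Bad, W, shA, shB, Wsh, δ)` gives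
the three faces of K3⁷ stub 2 on the caricature carriers with run-B rate `κ·p_K` (any `l₀ ≥ 0`, any `vol`), then `Σ_K n_K p_K < ∞` — dag-n20-w1's ★★★
`summable_stat_of_faces_caricature` BY NAME, then `Λ_K ≥ n_K p_K (κ−1)²∕(1+κ)`. [folklore ∕ bookkeeping] -/
theorem summable_meanCount_of_faces_caricature_ratio (hκ : 0 ≤ κ) (hκ1 : κ ≠ 1) (hp : ∀ K, 0 ≤ p K ∧ p K ≤ 1) (hq1 : ∀ K, κ * p K ≤ 1)
    {l₀ : ℝ} (hl₀ : 0 ≤ l₀) {vol : ℝ} {Bad : ℕ → ℝ → Finset (Finset ℕ)} {W : ℕ → ℝ} {shA shB : ℕ → ℝ → Finset ℕ → ℝ} {Wsh δ : ℕ → ℝ}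
    (hW : RelWeightBound l₀ (fun K => (Finset.range (n K)).powerset) (fun K _ S => p K ^ S.card * (1 - p K) ^ (n K - S.card))
      (fun K _ S => (κ * p K) ^ S.card * (1 - κ * p K) ^ (n K - S.card)) Bad W)
    (hSh : ShellWeightBound l₀ (fun K => (Finset.range (n K)).powerset) (fun K _ S => p K ^ S.card * (1 - p K) ^ (n K - S.card))
      (fun K _ S => (κ * p K) ^ S.card * (1 - κ * p K) ^ (n K - S.card)) shA shB Wsh)
    (hcore : Core l₀ vol (fun K => (Finset.range (n K)).powerset) Bad (fun K t S => p K ^ S.card * (1 - p K) ^ (n K - S.card) - shA K t S)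
      (fun K t S => (κ * p K) ^ S.card * (1 - κ * p K) ^ (n K - S.card) - shB K t S) δ) (hδ : Summable δ) :
    Summable fun K => (n K : ℝ) * p K := by
  have hq : ∀ K, 0 ≤ κ * p K ∧ κ * p K ≤ 1 := fun K => ⟨mul_nonneg hκ (hp K).1, hq1 K⟩
  have hΛ := summable_stat_of_faces_caricature n p (fun K => κ * p K)
    (fun K => n K * (((κ * p K) - p K) ^ 2 / (p K + κ * p K) + ((κ * p K) - p K) ^ 2 / (2 - p K - κ * p K))) hp hq (fun K => rfl) hl₀ hW hSh hcore hδ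
  have hc : 0 < (κ - 1) ^ 2 / (1 + κ) := div_pos (by positivity) (by linarith)
  have hdom : Summable fun K => (n K : ℝ) * p K * ((κ - 1) ^ 2 / (1 + κ)) :=
    Summable.of_nonneg_of_le (fun K => mul_nonneg (mul_nonneg (Nat.cast_nonneg _) (hp K).1) hc.le)
      (fun K => stat_ratio_ge hκ (hp K).1 (hp K).2 (hq1 K) (n K)) hΛ
  have h := hdom.mul_right ((κ - 1) ^ 2 / (1 + κ))⁻¹
  refine h.congr fun K => ?_
  rw [mul_assoc, mul_inv_cancel₀ hc.ne', mul_one]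

/-- The bundled form: `HybridNE7` on the caricature carriers for SOME six dials ⇒ `Σ_K n_K p_K < ∞`. [bookkeeping] -/
theorem summable_meanCount_of_hybridNE7_caricature_ratio (hκ : 0 ≤ κ) (hκ1 : κ ≠ 1) (hp : ∀ K, 0 ≤ p K ∧ p K ≤ 1) (hq1 : ∀ K, κ * p K ≤ 1)
    {l₀ : ℝ} (hl₀ : 0 ≤ l₀) {vol : ℝ}
    (h : ∃ (Bad : ℕ → ℝ → Finset (Finset ℕ)) (W : ℕ → ℝ) (shA shB : ℕ → ℝ → Finset ℕ → ℝ) (Wsh δ : ℕ → ℝ),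
      HybridNE7 l₀ vol (fun K => (Finset.range (n K)).powerset) (fun K _ S => p K ^ S.card * (1 - p K) ^ (n K - S.card))
        (fun K _ S => (κ * p K) ^ S.card * (1 - κ * p K) ^ (n K - S.card)) Bad W shA shB Wsh δ) :
    Summable fun K => (n K : ℝ) * p K := by
  obtain ⟨Bad, W, shA, shB, Wsh, δ, h⟩ := h
  exact summable_meanCount_of_faces_caricature_ratio n p κ hκ hκ1 hp hq1 hl₀ h.weight h.shell (core_of_hybridNE7 h) h.summable

end Ratio

/-! ## §3 Sufficiency at a fixed ratio (the linear bound fed to dag-n20-w4's road) and the characterisation [folklore + p609004 BY NAME] -/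

section Iff

/-- With `κ > 0` the per-block affinity at rates `p ∈ [0,1]`, `κp` is POSITIVE (`p = 0`: `u = 1`; `p > 0`: `√(p·κp) > 0`) — the caricature's two class laws are never
mutually singular at a positive ratio (dag-n20-w1's `affinity₁_pos` asks `p ∈ (0,1)` instead). [folklore] -/
theorem affinity₁_ratio_pos {κ p : ℝ} (hκ : 0 < κ) (hp0 : 0 ≤ p) :
    0 < Real.sqrt (p * (κ * p)) + Real.sqrt ((1 - p) * (1 - κ * p)) := by
  rcases hp0.eq_or_lt with h0 | hpos
  · rw [← h0]; norm_num
  · have h1 : 0 < Real.sqrt (p * (κ * p)) := Real.sqrt_pos.2 (by positivity)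
    exact add_pos_of_pos_of_nonneg h1 (Real.sqrt_nonneg _)

variable (n : ℕ → ℕ) (p : ℕ → ℝ) (κ : ℝ)

/-- ★★ **SUFFICIENCY AT A FIXED RATIO: `Σ_K n_K p_K < ∞` IS SERVED, BY THE SHELL DIAL, WITH THE LINEAR RADIUS.**  `κ > 0`, rates `p_K, κp_K ∈ [0,1]`, any `l₀ ≥ 0`, any
`vol`: if `Σ_K n_K p_K < ∞` then SOME shells and shell weights give node U5's bundled `HybridNE7` on the caricature carriers with `Bad = ∅`, `W = 0`, `δ = 0` — dag-n20-w4's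
`exists_hybridNE7_of_target_of_classLawTV` (p609004) BY NAME at the target `Target vol l₀ 0 1` (totals `≡ 1`), its per-set TV hypothesis supplied by §1 (`≤ n_K p_K|κ − 1|`,
summable) capped by `√(1 − u_K^{2 n_K}) < 1` (dag-n20-w1 FILE A `abs_sub_le_sqrt_one_sub_affinity_sq` ∘ `affinity_config_eq_pow`). [folklore ∕ bookkeeping] -/
theorem exists_hybridNE7_caricature_of_summable_meanCount (hκ : 0 < κ) (hp : ∀ K, 0 ≤ p K ∧ p K ≤ 1) (hq1 : ∀ K, κ * p K ≤ 1)
    {l₀ : ℝ} (hl₀ : 0 ≤ l₀) (vol : ℝ) (hs : Summable fun K => (n K : ℝ) * p K) :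
    ∃ (shA shB : ℕ → ℝ → Finset ℕ → ℝ) (Wsh : ℕ → ℝ),
      HybridNE7 l₀ vol (fun K => (Finset.range (n K)).powerset) (fun K _ S => p K ^ S.card * (1 - p K) ^ (n K - S.card))
        (fun K _ S => (κ * p K) ^ S.card * (1 - κ * p K) ^ (n K - S.card)) (fun _ _ => ∅) (fun _ => 0) shA shB Wsh (fun _ => 0) := by
  have hq : ∀ K, 0 ≤ κ * p K ∧ κ * p K ≤ 1 := fun K => ⟨mul_nonneg hκ.le (hp K).1, hq1 K⟩
  -- the TV radius paid as shell weight: the linear bound capped by Le Cam's upper bound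
  set ρ : ℕ → ℝ := fun K => min ((n K : ℝ) * p K * |κ - 1|)
    (Real.sqrt (1 - (Real.sqrt (p K * (κ * p K)) + Real.sqrt ((1 - p K) * (1 - κ * p K))) ^ (n K * 2))) with hρ
  have hρ0 : ∀ K, 0 ≤ ρ K := fun K =>
    le_min (mul_nonneg (mul_nonneg (Nat.cast_nonneg _) (hp K).1) (abs_nonneg _)) (Real.sqrt_nonneg _)
  have hρ1 : ∀ K, ρ K < 1 := fun K => by
    refine min_lt_iff.2 (Or.inr ?_)
    have hu := affinity₁_ratio_pos hκ (hp K).1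
    refine (Real.sqrt_lt' one_pos).2 ?_
    rw [one_pow]
    linarith [pow_pos hu (n K * 2)]
  have hρs : Summable ρ := by
    refine Summable.of_nonneg_of_le hρ0 (fun K => min_le_left _ _) ?_
    simpa [mul_assoc] using hs.mul_right |κ - 1|
  have hT : Target vol l₀ (fun _ => 0) (fun _ _ => (1 : ℝ)) := ⟨fun K => ⟨0, fun t _ => by simp⟩, summable_zero⟩
  obtain ⟨shA, shB, h⟩ := exists_hybridNE7_of_target_of_classLawTV (vol := vol) (T := fun K => (Finset.range (n K)).powerset)
    (A := fun K _ S => p K ^ S.card * (1 - p K) ^ (n K - S.card)) (B := fun K _ S => (κ * p K) ^ S.card * (1 - κ * p K) ^ (n K - S.card)) hl₀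
    (fun K t _ S _ => config_nonneg (hp K).1 (hp K).2 (n K) S) (fun K t _ S _ => config_nonneg (hq K).1 (hq K).2 (n K) S)
    (fun K t _ => by rw [sum_config_eq_one]; exact one_pos) (fun K t _ => by rw [sum_config_eq_one]; exact one_pos)
    (Z := fun _ _ => (1 : ℝ)) (fun K t _ => (sum_config_eq_one (p K) (n K)).symm) (fun K t _ => (sum_config_eq_one (κ * p K) (n K)).symm) hT
    hρ0 hρ1 hρs (fun K t _ 𝒮 h𝒮 => by
      rw [sum_config_eq_one, sum_config_eq_one, div_one, div_one, abs_sub_comm]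
      refine le_min ?_ ?_
      · have h := abs_config_classLaw_sub_le (hp K).1 (hp K).2 (hq K).1 (hq K).2 (n K) h𝒮
        calc _ ≤ (n K : ℝ) * |κ * p K - p K| := h
          _ = (n K : ℝ) * p K * |κ - 1| := by
              rw [show κ * p K - p K = p K * (κ - 1) by ring, abs_mul, abs_of_nonneg (hp K).1]; ring
      · have h := abs_sub_le_sqrt_one_sub_affinity_sq (Finset.range (n K)).powerset
          (a := fun S => p K ^ S.card * (1 - p K) ^ (n K - S.card)) (b := fun S => (κ * p K) ^ S.card * (1 - κ * p K) ^ (n K - S.card))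
          (fun S _ => config_nonneg (hp K).1 (hp K).2 (n K) S) (fun S _ => config_nonneg (hq K).1 (hq K).2 (n K) S)
          (sum_config_eq_one (p K) (n K)) (sum_config_eq_one (κ * p K) (n K)) h𝒮
        rw [affinity_config_eq_pow (hp K).1 (hq K).1 (hp K).2 (hq K).2 (n K), ← pow_mul] at h
        exact h)
  exact ⟨shA, shB, ρ, h⟩

/-- ★★★★ **AT A FIXED RATE RATIO THE BUNDLED BINDER LIST ON THE CARICATURE IS EXACTLY «SUMMABLE MEAN LARGE-FIELD COUNT».**  `κ > 0`, `κ ≠ 1`, rates `p_K, κp_K ∈ [0,1]`,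
`l₀ ≥ 0`, any `vol`: `(∃ Bad W shA shB Wsh δ, HybridNE7 …) ⟺ Σ_K n_K p_K < ∞` — dag-n20-w1's `ℓ¹ ∕ ℓ^{1∕2}` squeeze (FILE C) CLOSES in the rare regime. [folklore ∕ bookkeeping] -/
theorem exists_hybridNE7_caricature_iff_summable_meanCount (hκ : 0 < κ) (hκ1 : κ ≠ 1) (hp : ∀ K, 0 ≤ p K ∧ p K ≤ 1)
    (hq1 : ∀ K, κ * p K ≤ 1) {l₀ : ℝ} (hl₀ : 0 ≤ l₀) (vol : ℝ) :
    (∃ (Bad : ℕ → ℝ → Finset (Finset ℕ)) (W : ℕ → ℝ) (shA shB : ℕ → ℝ → Finset ℕ → ℝ) (Wsh δ : ℕ → ℝ),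
      HybridNE7 l₀ vol (fun K => (Finset.range (n K)).powerset) (fun K _ S => p K ^ S.card * (1 - p K) ^ (n K - S.card))
        (fun K _ S => (κ * p K) ^ S.card * (1 - κ * p K) ^ (n K - S.card)) Bad W shA shB Wsh δ) ↔
    Summable fun K => (n K : ℝ) * p K := by
  constructor
  · exact summable_meanCount_of_hybridNE7_caricature_ratio n p κ hκ.le hκ1 hp hq1 hl₀
  · intro hs
    obtain ⟨shA, shB, Wsh, h⟩ := exists_hybridNE7_caricature_of_summable_meanCount n p κ hκ hp hq1 hl₀ vol hs
    exact ⟨_, _, shA, shB, Wsh, _, h⟩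

/-- ★★ **THE SAME IN THE STUB-2 FACE-TRIPLE SHAPE** (`RelWeightBound ∧ ShellWeightBound ∧ (Core ∧ Summable δ)` on the caricature carriers). [bookkeeping] -/
theorem faces_caricature_iff_summable_meanCount (hκ : 0 < κ) (hκ1 : κ ≠ 1) (hp : ∀ K, 0 ≤ p K ∧ p K ≤ 1) (hq1 : ∀ K, κ * p K ≤ 1)
    {l₀ : ℝ} (hl₀ : 0 ≤ l₀) (vol : ℝ) :
    (∃ (Bad : ℕ → ℝ → Finset (Finset ℕ)) (W : ℕ → ℝ) (shA shB : ℕ → ℝ → Finset ℕ → ℝ) (Wsh δ : ℕ → ℝ),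
      RelWeightBound l₀ (fun K => (Finset.range (n K)).powerset) (fun K _ S => p K ^ S.card * (1 - p K) ^ (n K - S.card))
        (fun K _ S => (κ * p K) ^ S.card * (1 - κ * p K) ^ (n K - S.card)) Bad W ∧
      ShellWeightBound l₀ (fun K => (Finset.range (n K)).powerset) (fun K _ S => p K ^ S.card * (1 - p K) ^ (n K - S.card))
        (fun K _ S => (κ * p K) ^ S.card * (1 - κ * p K) ^ (n K - S.card)) shA shB Wsh ∧
      (Core l₀ vol (fun K => (Finset.range (n K)).powerset) Bad (fun K t S => p K ^ S.card * (1 - p K) ^ (n K - S.card) - shA K t S)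
        (fun K t S => (κ * p K) ^ S.card * (1 - κ * p K) ^ (n K - S.card) - shB K t S) δ ∧ Summable δ)) ↔
    Summable fun K => (n K : ℝ) * p K := by
  constructor
  · rintro ⟨Bad, W, shA, shB, Wsh, δ, hW, hSh, hcore, hδ⟩
    exact summable_meanCount_of_faces_caricature_ratio n p κ hκ.le hκ1 hp hq1 hl₀ hW hSh hcore hδ
  · intro hs
    obtain ⟨shA, shB, Wsh, h⟩ := exists_hybridNE7_caricature_of_summable_meanCount n p κ hκ hp hq1 hl₀ vol hs
    exact ⟨fun _ _ => ∅, fun _ => 0, shA, shB, Wsh, fun _ => 0, h.weight, h.shell, core_of_hybridNE7 h, h.summable⟩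

end Iff

end Summit.QuantumFields.YangMills.BalabanUVNodes.N19BlockCaricatureFixedRatio

end
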